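import Summits.BirchSwinnertonDyer.BirchSwinnertonDyer.Theorems.TameQuarticSolventTprimeNoThreeTorsionCompletion
import Summits.BirchSwinnertonDyer.BirchSwinnertonDyer.Theorems.TameQuarticSolventTprimeLocIrrThreeCriterion
import HarnessLib

/-!
# Route `TameQuarticSolvent`, crux `SolventPairLowerBound` (stmt-BirchSwinnertonDyer-21391) — sub-row B of the
# (t′) leaf: `E(M)[3] = 0` for every number field `M` with a place `w ∣ 3` of ramification `4·(odd)`

HONEST FRAMING. Theorems only; helper (`--supports stmt-BirchSwinnertonDyer-21391 --as helper`) of width seat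
bsd-wall-tqs-p1-w2 g7; the GLOBAL corollary of `tprime_subrowB_threeTorsion_completion_eq_zero` (p604948) by the
injection `E(M) ↪ E(M_w)` (Mathlib `WeierstrassCurve.Affine.Point.map_injective`). BSD is not proved by any of
this; nothing here closes 21391 or 23963 — it is a typed local input for the K1⁻ text (23963: `M` totally real
quartic, `e(w∣3) = 4` at every `w ∣ 3`): **on sub-row B the base-changed curve `W ⊗ M` has no `M`-rational point
of order `3`.**

WHAT. `tprime_subrowB_threeTorsion_numberField_eq_zero`: `W/ℚ` globally minimal, elliptic, `Addv W 3`,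
`SubTprime W 3`, sub-row B (`c₆ = 0 ∨ 2·ord₃ c₆ ≠ ord₃ Δ + 3`); `M` a number field with a place `w` over `3` of
ramification index `e(w∣3) = 4·m'`, `m'` odd. Then `3 • P = 0 ⇒ P = 0` for every `P ∈ (W ⊗ M)(M)`.
`tprime_threeTorsion_numberField_eq_zero_of_locIrr`: the same with sub-row B phrased as `LocIrr W 3` («`E[3]|G_{ℚ₃}`
irreducible», the Fouquet–Wan local hypothesis of route KT), by w3 g5's `tprime_locIrr_three_iff` (p598630).

References: J.-P. Serre, Invent. Math. 15 (1972) §1; J. H. Silverman, *AEC* VII.3, VIII.7.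
[cite: SilvermanAEC2009, IV.6.1]
-/

-- D-0017: single-problem summit, so `Summit.BirchSwinnertonDyer.BirchSwinnertonDyer.…` repeats a namespace BY DESIGN.
set_option linter.dupNamespace false

noncomputable section

namespace Summit.BirchSwinnertonDyer.BirchSwinnertonDyer.Theorems.SolventPairLowerBound

open WeierstrassCurve Literature.NumberTheory.EllipticCurves.Rank1Residual
  Summit.BirchSwinnertonDyer.Rank1Residual.Additive NumberField
  Summit.BirchSwinnertonDyer.BirchSwinnertonDyer.Theorems.KPort

section NumberField

/-- **Sub-row B of the (t′) leaf: `E(M)[3] = 0`** for every number field `M` having a place `w ∣ 3` with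
`e(w∣3) = 4·(odd)` (e.g. the tame quartic field of line `birth`, `e = 4` at every `w ∣ 3`, and its `3`-cyclotomic
layers). See the module docstring. [Serre 1972 §1] [cite: SilvermanAEC2009, IV.6.1] -/
theorem tprime_subrowB_threeTorsion_numberField_eq_zero (W : WeierstrassCurve ℚ) [W.IsElliptic]
    [W.IsGloballyMinimal] (hadd : Addv W 3) (hsub : SubTprime W 3)
    (hB : W.c₆ = 0 ∨ 2 * padicValRat 3 W.c₆ ≠ padicValRat 3 W.Δ + 3)
    (M : Type) [Field M] [NumberField M]
    (w : ((Rat.HeightOneSpectrum.primesEquiv (R := 𝓞 ℚ)).symm ⟨3, Nat.prime_three⟩).Extension (𝓞 M))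
    {m' : ℕ} (hm' : Odd m') (he : w.1.asIdeal.ramificationIdx (𝓞 ℚ) = 4 * m') [DecidableEq M]
    (P : (W.baseChange M).toAffine.Point) (h3P : 3 • P = 0) : P = 0 := by
  classical
  haveI : Fact (Nat.Prime 3) := ⟨Nat.prime_three⟩
  haveI : CharZero (Kw 3 M w) := charZero_of_injective_algebraMap (algebraMap ℚ_[3] (Kw 3 M w)).injective
  -- the embedding `M → M_w` as a `ℚ`-algebra map
  let f₀ : M →+* Kw 3 M w := (algebraMap M (w.1.adicCompletion M) : M →+* w.1.adicCompletion M)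
  let f : M →ₐ[ℚ] Kw 3 M w := f₀.toRatAlgHom
  -- no `3`-torsion over `M_w`
  have hcurve : (W.baseChange ℚ_[3]).map (algebraMap ℚ_[3] (Kw 3 M w)) = W.baseChange (Kw 3 M w) := by
    rw [WeierstrassCurve.baseChange, WeierstrassCurve.map_map, WeierstrassCurve.baseChange]
    congr 1
    exact Subsingleton.elim _ _
  have key : ∀ Q : ((W.baseChange ℚ_[3]).map (algebraMap ℚ_[3] (Kw 3 M w))).toAffine.Point,
      3 • Q = 0 → Q = 0 := fun Q hQ ↦
    tprime_subrowB_threeTorsion_completion_eq_zero W hadd hsub hB M w hm' he Q hQ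
  rw [hcurve] at key
  -- pull back along the injection `E(M) ↪ E(M_w)`
  have hQ : WeierstrassCurve.Affine.Point.map f P = 0 :=
    key (WeierstrassCurve.Affine.Point.map f P) (by rw [← map_nsmul, h3P, map_zero])
  exact WeierstrassCurve.Affine.Point.map_injective f (by rw [hQ, map_zero])

/-- **(t′) at `3` with `E[3]` locally irreducible at `3` ⇒ `E(M)[3] = 0`** for every number field `M` with a place
`w ∣ 3` of ramification `4·(odd)`: the `LocIrr` phrasing of `tprime_subrowB_threeTorsion_numberField_eq_zero`
(`LocIrr W 3 ↔` sub-row B on the (t′) leaf, w3 g5's `tprime_locIrr_three_iff`). [Serre 1972 §1]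
[cite: SilvermanAEC2009, IV.6.1] -/
theorem tprime_threeTorsion_numberField_eq_zero_of_locIrr (W : WeierstrassCurve ℚ) [W.IsElliptic]
    [W.IsGloballyMinimal] (hadd : Addv W 3) (hsub : SubTprime W 3) (hirr : LocIrr W 3)
    (M : Type) [Field M] [NumberField M]
    (w : ((Rat.HeightOneSpectrum.primesEquiv (R := 𝓞 ℚ)).symm ⟨3, Nat.prime_three⟩).Extension (𝓞 M))
    {m' : ℕ} (hm' : Odd m') (he : w.1.asIdeal.ramificationIdx (𝓞 ℚ) = 4 * m') [DecidableEq M]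
    (P : (W.baseChange M).toAffine.Point) (h3P : 3 • P = 0) : P = 0 :=
  tprime_subrowB_threeTorsion_numberField_eq_zero W hadd hsub ((tprime_locIrr_three_iff W hadd hsub).mp hirr) M w
    hm' he P h3P

end NumberField

end Summit.BirchSwinnertonDyer.BirchSwinnertonDyer.Theorems.SolventPairLowerBound

end
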